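import Summits.RiemannHypothesis.RiemannHypothesis.Theorems.JensenPolynomialsXiGorttwCoeffSmallTableCertLow
import Summits.RiemannHypothesis.RiemannHypothesis.Theses.JensenPolynomials

/-!
# Route `JensenPolynomials` — TABLE crux, part 4c: degrees `12 … 17` and the certified table

**RH-FREE proof-of-data (rung J-P(P1′)); CONDITIONAL on ONE enclosure hypothesis (certified numerics, two
lineages — NOT a kernel fact; evidence class of the tree's degree-`≤ 8` rows `JensenXiDegEightBallsA…F`, J-n2);
COMPUTATIONAL (`native_decide`).**

`xiGorttwCoeffSmallTable_of_ratioEncloses :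
   RatioEncloses xiRatioBox xiTaylorCoeff → Theses.JensenPolynomials.XiGorttwCoeffSmallTable`
(`= XiGorttwCoeffSmallBelow rhoWinMin 10000`): if `(c_m − 1)/10^{E(m)} ≤ γ(m+1)/γ(m) ≤ (c_m + 1)/10^{E(m)}` for the
`10017` centres of `XiTaylorRatioCentresA/B/C` (`m ≤ 10016`), then for every `3 ≤ d` and `2d³ ≤ n < 10⁴` (`d ≤ 17`,
`103 200` cells) both weighted `ℓ¹` sums of GORTTW's Hermite coefficients `c_{d,n,j}` of `J̃^{d,n}_ξ` are `< 1` (table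
`rhoWinMin`). Parts: 1 `…Algebra` (closed form), 2 `…Check` (interval checker), 3 `…Sound` (`cellSmall_of_checkCell`),
4a `…Cert` (hypothesis, box, walkers, tables, per-degree lemma), 4b `…CertLow` (`walk_3 … walk_11`), this file (`walk_12 … walk_17`, assembly by `interval_cases`).
An exact-ℚ Python mirror of `checkCell` on the same data reproduces the engine's certified maxima `0.392747 / 0.089655`
at `(17, 9826)` (column data file `rh-jensen/DATA.md` §17/§20). Nothing here bears on the truth of RH.
-/

-- D-0017: `Summit.RiemannHypothesis.RiemannHypothesis.…` duplicates the namespace BY DESIGN (single-problem summit).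
set_option linter.dupNamespace false

namespace Summit.RiemannHypothesis.RiemannHypothesis.Theorems.JensenPolynomials.CoeffTable

open Literature.NumberTheory.LFunctions Polynomial Finset
open scoped BigOperators Nat

/-! ## The remaining degrees (compiled evaluation) -/

/-- Degree `12`: all `6544` cells `2·12³ ≤ n < 10⁴` pass the checker (compiled evaluation, `Lean.ofReduceBool`). -/
theorem walk_12 : walk 12 (Rtab 12) (1 / (stab 12 + 1)) (sTab 12) (xiRatioBox.drop 3456) 6544 = true := by
  native_decide

/-- Degree `13`: all `5606` cells `2·13³ ≤ n < 10⁴` pass the checker (compiled evaluation, `Lean.ofReduceBool`). -/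
theorem walk_13 : walk 13 (Rtab 13) (1 / (stab 13 + 1)) (sTab 13) (xiRatioBox.drop 4394) 5606 = true := by
  native_decide

/-- Degree `14`: all `4512` cells `2·14³ ≤ n < 10⁴` pass the checker (compiled evaluation, `Lean.ofReduceBool`). -/
theorem walk_14 : walk 14 (Rtab 14) (1 / (stab 14 + 1)) (sTab 14) (xiRatioBox.drop 5488) 4512 = true := by
  native_decide

/-- Degree `15`: all `3250` cells `2·15³ ≤ n < 10⁴` pass the checker (compiled evaluation, `Lean.ofReduceBool`). -/
theorem walk_15 : walk 15 (Rtab 15) (1 / (stab 15 + 1)) (sTab 15) (xiRatioBox.drop 6750) 3250 = true := by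
  native_decide

/-- Degree `16`: all `1808` cells `2·16³ ≤ n < 10⁴` pass the checker (compiled evaluation, `Lean.ofReduceBool`). -/
theorem walk_16 : walk 16 (Rtab 16) (1 / (stab 16 + 1)) (sTab 16) (xiRatioBox.drop 8192) 1808 = true := by
  native_decide

/-- Degree `17`: all `174` cells `2·17³ ≤ n < 10⁴` pass the checker (compiled evaluation, `Lean.ofReduceBool`). -/
theorem walk_17 : walk 17 (Rtab 17) (1 / (stab 17 + 1)) (sTab 17) (xiRatioBox.drop 9826) 174 = true := by
  native_decide

/-! ## The table crux under the enclosure hypothesis -/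

/-- **TABLE crux of route «JensenPolynomials», CONDITIONAL form (RH-FREE; certified-numerics hypothesis, two lineages;
computational: `Lean.ofReduceBool`).** If the ratio box encloses `γ(m+1)/γ(m)` for `γ = xiTaylorCoeff`, `m ≤ 10016`,
then `XiGorttwCoeffSmallBelow rhoWinMin 10000`: for all `3 ≤ d`, `2d³ ≤ n < 10⁴`, both weighted `ℓ¹` sums of GORTTW's
Hermite coefficients of `J̃^{d,n}_ξ` are `< 1`. -/
theorem xiGorttwCoeffSmallBelow_of_ratioEncloses (hγ : RatioEncloses xiRatioBox xiTaylorCoeff) :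
    XiGorttwCoeffSmallBelow rhoWinMin 10000 := by
  intro d n h3 hn hN
  have h17 : d ≤ 17 := by
    by_contra h
    have : 18 ^ 3 ≤ d ^ 3 := Nat.pow_le_pow_left (by omega) 3
    omega
  interval_cases d
  · exact cell 3 (by norm_num) (by norm_num) hn hN walk_3 hγ
  · exact cell 4 (by norm_num) (by norm_num) hn hN walk_4 hγ
  · exact cell 5 (by norm_num) (by norm_num) hn hN walk_5 hγ
  · exact cell 6 (by norm_num) (by norm_num) hn hN walk_6 hγ
  · exact cell 7 (by norm_num) (by norm_num) hn hN walk_7 hγ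
  · exact cell 8 (by norm_num) (by norm_num) hn hN walk_8 hγ
  · exact cell 9 (by norm_num) (by norm_num) hn hN walk_9 hγ
  · exact cell 10 (by norm_num) (by norm_num) hn hN walk_10 hγ
  · exact cell 11 (by norm_num) (by norm_num) hn hN walk_11 hγ
  · exact cell 12 (by norm_num) (by norm_num) hn hN walk_12 hγ
  · exact cell 13 (by norm_num) (by norm_num) hn hN walk_13 hγ
  · exact cell 14 (by norm_num) (by norm_num) hn hN walk_14 hγ
  · exact cell 15 (by norm_num) (by norm_num) hn hN walk_15 hγ
  · exact cell 16 (by norm_num) (by norm_num) hn hN walk_16 hγ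
  · exact cell 17 (by norm_num) (by norm_num) hn hN walk_17 hγ


/-- **Route item `stmt-RiemannHypothesis-19710` (`Theses.JensenPolynomials.XiGorttwCoeffSmallTable`) under the
enclosure hypothesis** — the item's statement literally, CONDITIONAL on `RatioEncloses xiRatioBox xiTaylorCoeff`
(certified numerics; RH-FREE; computational). -/
theorem xiGorttwCoeffSmallTable_of_ratioEncloses (hγ : RatioEncloses xiRatioBox xiTaylorCoeff) :
    Summit.RiemannHypothesis.RiemannHypothesis.Theses.JensenPolynomials.XiGorttwCoeffSmallTable :=
  xiGorttwCoeffSmallBelow_of_ratioEncloses hγ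

end Summit.RiemannHypothesis.RiemannHypothesis.Theorems.JensenPolynomials.CoeffTable
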